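import Mathlib.NumberTheory.Padics.RingHoms
import Mathlib.Algebra.MvPolynomial.PDeriv
import Mathlib.Algebra.MvPolynomial.Monad
import Mathlib.Topology.MetricSpace.Contracting
import Mathlib.Analysis.Normed.Group.Ultra
import Mathlib.LinearAlgebra.Matrix.NonsingularInverse
import HarnessLib

/-!
# The multivariate Hensel lemma over `ℤ_p` (unit Jacobian), via divided differences

Topic `Literature/NumberTheory/LFunctions` (toolkit for Wooley's theorem on simultaneous
congruences, used in Ford's bounds for Vinogradov's integral). Everything here is PROVED; no
definition is a named fact.

* `Wooley.exists_divDiff` — divided differences for multivariate integer polynomials: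
  `f(X) − f(Y) = ∑ᵢ (Xᵢ − Yᵢ) gᵢ(X, Y)` with `gᵢ(X, X) = ∂ᵢ f(X)`.
* `Wooley.aeval_sub_aeval_mem_span_pow` — `x ≡ y (mod pˢ) ⟹ f(x) ≡ f(y) (mod pˢ)` in `ℤ_p`.
* `Wooley.hensel_mv` — for a square system `F : Fin d → ℤ[x₁,…,x_d]`, a point `a ∈ ℤ_pᵈ` with
  `F(a) ≡ 0 (mod pˢ)` (`s ≥ 1`) and `det (∂Fⱼ/∂xᵢ)(a)` a `p`-adic unit, there is exactly one
  `b ≡ a (mod pˢ)` in `ℤ_pᵈ` with `F(b) = 0` (simplified Newton iteration `x ↦ x − J(a)⁻¹F(x)` is a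
  contraction of the closed ball).

## References

* T. D. Wooley, *A note on simultaneous congruences*, J. Number Theory 58 (1996), 288–297,
  Lemma 3 (there after M. J. Greenberg, *Lectures on forms in many variables*, Prop. 5.20).
  [Wooley1996]
-/

noncomputable section

open MvPolynomial

namespace Literature.NumberTheory.LFunctions
namespace Wooley

/-! ## Divided differences -/

section DivDiff

variable {σ : Type*} [Fintype σ] [DecidableEq σ]

/-- **Divided differences.** For `f ∈ ℤ[Xᵢ : i ∈ σ]` there are polynomials `gᵢ` in the doubled
set of variables with `f(X) − f(Y) = ∑ᵢ (Xᵢ − Yᵢ) gᵢ(X,Y)` and `gᵢ(X,X) = ∂f/∂Xᵢ`. [folklore] -/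
theorem exists_divDiff (f : MvPolynomial σ ℤ) :
    ∃ g : σ → MvPolynomial (σ ⊕ σ) ℤ,
      rename Sum.inl f - rename Sum.inr f = ∑ i, (X (Sum.inl i) - X (Sum.inr i)) * g i ∧
      ∀ i, bind₁ (Sum.elim X X) (g i) = pderiv i f := by
  induction f using MvPolynomial.induction_on with
  | C a =>
    refine ⟨0, ?_, fun i ↦ ?_⟩
    · simp
    · simp
  | add p q hp hq =>
    obtain ⟨g₁, h₁, d₁⟩ := hp
    obtain ⟨g₂, h₂, d₂⟩ := hq
    refine ⟨g₁ + g₂, ?_, fun i ↦ ?_⟩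
    · simp only [map_add, Pi.add_apply, mul_add, Finset.sum_add_distrib, ← h₁, ← h₂]
      ring
    · simp only [Pi.add_apply, map_add, d₁, d₂]
  | mul_X p n hp =>
    obtain ⟨g, h, d⟩ := hp
    refine ⟨fun i ↦ g i * X (Sum.inl n) + (if i = n then rename Sum.inr p else 0), ?_, fun i ↦ ?_⟩
    · have e1 : rename Sum.inl (p * X n) - rename Sum.inr (p * X n)
          = (rename Sum.inl p - rename Sum.inr p) * X (Sum.inl n)
            + rename Sum.inr p * (X (Sum.inl n) - X (Sum.inr n)) := by
        simp only [map_mul, rename_X]; ring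
      rw [e1, h, Finset.sum_mul]
      have e2 : ∑ i, (X (Sum.inl i) - X (Sum.inr i)) * (g i * X (Sum.inl n)
            + (if i = n then rename Sum.inr p else 0))
          = ∑ i, (X (Sum.inl i) - X (Sum.inr i)) * g i * X (Sum.inl n)
            + ∑ i, (X (Sum.inl i) - X (Sum.inr i)) * (if i = n then rename Sum.inr p else 0) := by
        rw [← Finset.sum_add_distrib]
        refine Finset.sum_congr rfl fun i _ ↦ ?_
        ring
      rw [e2]
      have e3 : ∑ i, (X (Sum.inl i) - X (Sum.inr i)) * (if i = n then rename Sum.inr p else 0)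
          = ∑ i, (if i = n then (X (Sum.inl i) - X (Sum.inr i)) * rename Sum.inr p else 0) :=
        Finset.sum_congr rfl fun i _ ↦ by split_ifs <;> simp
      rw [e3, Finset.sum_ite_eq' Finset.univ n]
      simp only [Finset.mem_univ, if_true]
      ring
    · simp only [map_add, map_mul, bind₁_X_right, Sum.elim_inl, d]
      rw [(pderiv i).leibniz]
      simp only [smul_eq_mul]
      split_ifs with hin
      · subst hin
        rw [pderiv_X_self]
        have : bind₁ (Sum.elim X X) (rename Sum.inr p) = p := by
          rw [bind₁_rename]; simp
        rw [this]; ring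
      · rw [pderiv_X_of_ne (Ne.symm hin), map_zero]
        ring

end DivDiff

/-! ## Congruences under polynomial maps in `ℤ_p` -/

section Padic

variable {p : ℕ} [Fact p.Prime]

/-- Membership in `(pˢ)` is the norm condition `‖x‖ ≤ p⁻ˢ`. [folklore] -/
theorem mem_span_pow_iff_norm (x : ℤ_[p]) (s : ℕ) :
    x ∈ (Ideal.span {(p : ℤ_[p]) ^ s} : Ideal ℤ_[p]) ↔ ‖x‖ ≤ (p : ℝ) ^ (-(s : ℤ)) :=
  (PadicInt.norm_le_pow_iff_mem_span_pow x s).symm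

/-- Ring homomorphisms commute with the evaluation of integer polynomials. [folklore] -/
theorem ringHom_aeval {τ : Type*} {A B : Type*} [CommRing A] [CommRing B] (φ : A →+* B)
    (x : τ → A) (f : MvPolynomial τ ℤ) : φ (aeval x f) = aeval (fun i ↦ φ (x i)) f := by
  rw [MvPolynomial.aeval_def, MvPolynomial.eval₂_comp_left, MvPolynomial.aeval_def]
  congr 1
  exact RingHom.ext_int _ _

/-- If `x ≡ y (mod pˢ)` coordinatewise then `f(x) ≡ f(y) (mod pˢ)`. [folklore] -/
theorem aeval_sub_aeval_mem_span_pow {τ : Type*} (f : MvPolynomial τ ℤ) (x y : τ → ℤ_[p]) (s : ℕ)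
    (h : ∀ i, x i - y i ∈ (Ideal.span {(p : ℤ_[p]) ^ s} : Ideal ℤ_[p])) :
    aeval x f - aeval y f ∈ (Ideal.span {(p : ℤ_[p]) ^ s} : Ideal ℤ_[p]) := by
  set I : Ideal ℤ_[p] := Ideal.span {(p : ℤ_[p]) ^ s}
  rw [← Ideal.Quotient.eq, ringHom_aeval, ringHom_aeval]
  have : (fun i ↦ Ideal.Quotient.mk I (x i)) = fun i ↦ Ideal.Quotient.mk I (y i) :=
    funext fun i ↦ (Ideal.Quotient.eq).2 (h i)
  rw [this]

/-! ## The multivariate Hensel lemma -/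

variable {d : ℕ}

/-- The polynomial map of a square system. [folklore] -/
def FEval (F : Fin d → MvPolynomial (Fin d) ℤ) (x : Fin d → ℤ_[p]) : Fin d → ℤ_[p] :=
  fun j ↦ aeval x (F j)

/-- The Jacobian matrix `(∂Fⱼ/∂xᵢ)(x)`. [folklore] -/
def Jac (F : Fin d → MvPolynomial (Fin d) ℤ) (x : Fin d → ℤ_[p]) : Matrix (Fin d) (Fin d) ℤ_[p] :=
  Matrix.of fun j i ↦ aeval x (pderiv i (F j))

/-- The linearisation error on the ball `x, y ≡ a (mod pˢ)`:
`‖F(x) − F(y) − J(a)(x − y)‖ ≤ p⁻ˢ · dist(x, y)`, coordinatewise. [cite: Wooley1996, Lemma 3 (proof)] -/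
theorem norm_linearisation_le (F : Fin d → MvPolynomial (Fin d) ℤ) (a x y : Fin d → ℤ_[p]) (s : ℕ)
    (hx : ∀ i, x i - a i ∈ (Ideal.span {(p : ℤ_[p]) ^ s} : Ideal ℤ_[p]))
    (hy : ∀ i, y i - a i ∈ (Ideal.span {(p : ℤ_[p]) ^ s} : Ideal ℤ_[p])) (j : Fin d) :
    ‖FEval F x j - FEval F y j - (Jac F a).mulVec (x - y) j‖ ≤ (p : ℝ) ^ (-(s : ℤ)) * dist x y := by
  classical
  obtain ⟨g, hg, hdg⟩ := exists_divDiff (F j)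
  set I : Ideal ℤ_[p] := Ideal.span {(p : ℤ_[p]) ^ s}
  -- evaluate the divided-difference identity at `(x, y)`
  have h1 : aeval x (F j) - aeval y (F j) = ∑ i, (x i - y i) * aeval (Sum.elim x y) (g i) := by
    have := congrArg (aeval (Sum.elim x y)) hg
    simpa [aeval_rename, Function.comp_def] using this
  -- the diagonal values are the Jacobian entries
  have h2 : ∀ i, aeval (Sum.elim a a) (g i) = aeval a (pderiv i (F j)) := by
    intro i
    have e : (fun t ↦ aeval a (Sum.elim X X t : MvPolynomial (Fin d) ℤ)) = Sum.elim a a := by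
      funext t; rcases t with t | t <;> simp
    rw [← hdg i, aeval_bind₁, e]
  -- congruences `gᵢ(x,y) ≡ gᵢ(a,a) (mod pˢ)`
  have h3 : ∀ i, aeval (Sum.elim x y) (g i) - aeval (Sum.elim a a) (g i) ∈ I := by
    intro i
    refine aeval_sub_aeval_mem_span_pow (g i) _ _ s fun t ↦ ?_
    rcases t with t | t
    · simpa using hx t
    · simpa using hy t
  have hJ : (Jac F a).mulVec (x - y) j = ∑ i, aeval a (pderiv i (F j)) * (x i - y i) := by
    simp [Jac, Matrix.mulVec, dotProduct]
  have hE : FEval F x j - FEval F y j - (Jac F a).mulVec (x - y) j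
      = ∑ i, (x i - y i) * (aeval (Sum.elim x y) (g i) - aeval (Sum.elim a a) (g i)) := by
    simp only [FEval]
    rw [h1, hJ, ← Finset.sum_sub_distrib]
    refine Finset.sum_congr rfl fun i _ ↦ ?_
    rw [h2 i]; ring
  rw [hE]
  have hp0 : (0 : ℝ) < p := by exact_mod_cast (Fact.out : p.Prime).pos
  have hps : (0 : ℝ) ≤ (p : ℝ) ^ (-(s : ℤ)) := (zpow_pos hp0 _).le
  refine IsUltrametricDist.norm_sum_le_of_forall_le_of_nonneg (mul_nonneg hps dist_nonneg)
    fun i _ ↦ ?_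
  rw [norm_mul]
  have hc : ‖aeval (Sum.elim x y) (g i) - aeval (Sum.elim a a) (g i)‖ ≤ (p : ℝ) ^ (-(s : ℤ)) :=
    (mem_span_pow_iff_norm _ _).1 (h3 i)
  have hd : ‖x i - y i‖ ≤ dist x y := by
    rw [← dist_eq_norm]; exact dist_le_pi_dist x y i
  calc ‖x i - y i‖ * ‖aeval (Sum.elim x y) (g i) - aeval (Sum.elim a a) (g i)‖
      ≤ dist x y * (p : ℝ) ^ (-(s : ℤ)) := mul_le_mul hd hc (norm_nonneg _) dist_nonneg
    _ = _ := mul_comm _ _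

/-- **Multivariate Hensel lemma over `ℤ_p` (unit Jacobian).** If `F(a) ≡ 0 (mod pˢ)` with `s ≥ 1`
and `det (∂Fⱼ/∂xᵢ)(a)` is a unit of `ℤ_p`, then there is exactly one `b ∈ ℤ_pᵈ` with
`b ≡ a (mod pˢ)` and `F(b) = 0`. [cite: Wooley1996, Lemma 3] -/
theorem hensel_mv (F : Fin d → MvPolynomial (Fin d) ℤ) (a : Fin d → ℤ_[p]) {s : ℕ} (hs : 1 ≤ s)
    (ha : ∀ j, FEval F a j ∈ (Ideal.span {(p : ℤ_[p]) ^ s} : Ideal ℤ_[p]))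
    (hJ : IsUnit (Jac F a).det) :
    ∃! b : Fin d → ℤ_[p], (∀ j, FEval F b j = 0) ∧
      ∀ i, b i - a i ∈ (Ideal.span {(p : ℤ_[p]) ^ s} : Ideal ℤ_[p]) := by
  classical
  set I : Ideal ℤ_[p] := Ideal.span {(p : ℤ_[p]) ^ s}
  set J : Matrix (Fin d) (Fin d) ℤ_[p] := Jac F a
  set M : Matrix (Fin d) (Fin d) ℤ_[p] := J⁻¹
  have hMJ : M * J = 1 := Matrix.nonsing_inv_mul J hJ
  have hJM : J * M = 1 := Matrix.mul_nonsing_inv J hJ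
  -- the iteration map and the ball
  set Φ : (Fin d → ℤ_[p]) → (Fin d → ℤ_[p]) := fun x ↦ x - M.mulVec (FEval F x)
  set B : Set (Fin d → ℤ_[p]) := {x | ∀ i, x i - a i ∈ I}
  have hp0 : (0 : ℝ) < p := by exact_mod_cast (Fact.out : p.Prime).pos
  have hps : (0 : ℝ) < (p : ℝ) ^ (-(s : ℤ)) := zpow_pos hp0 _
  have hpr : (1 : ℝ) < p := by exact_mod_cast (Fact.out : p.Prime).one_lt
  have hK : (p : ℝ) ^ (-(s : ℤ)) ≤ 1 / 2 := by
    rw [zpow_neg, zpow_natCast, one_div]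
    apply inv_anti₀ (by norm_num)
    have h2 : (2 : ℝ) ≤ p := by exact_mod_cast (Fact.out : p.Prime).two_le
    calc (2 : ℝ) = 2 ^ 1 := by norm_num
      _ ≤ (p : ℝ) ^ 1 := by gcongr
      _ ≤ (p : ℝ) ^ s := pow_le_pow_right₀ hpr.le hs
  -- `F(x) ∈ I` on the ball
  have hFB : ∀ x ∈ B, ∀ j, FEval F x j ∈ I := by
    intro x hx j
    have := aeval_sub_aeval_mem_span_pow (F j) x a s hx
    have e : FEval F x j = (aeval x (F j) - aeval a (F j)) + FEval F a j := by simp [FEval]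
    rw [e]; exact I.add_mem this (ha j)
  -- matrices over `ℤ_p` map vectors in `I` to vectors in `I`
  have hmulI : ∀ (N : Matrix (Fin d) (Fin d) ℤ_[p]) (v : Fin d → ℤ_[p]), (∀ i, v i ∈ I) →
      ∀ i, N.mulVec v i ∈ I := by
    intro N v hv i
    simp only [Matrix.mulVec, dotProduct]
    exact I.sum_mem fun k _ ↦ I.mul_mem_left _ (hv k)
  have hmaps : Set.MapsTo Φ B B := by
    intro x hx i
    have e : Φ x i - a i = (x i - a i) - M.mulVec (FEval F x) i := by
      simp only [Φ, Pi.sub_apply]; ring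
    rw [e]
    exact I.sub_mem (hx i) (hmulI M _ (hFB x hx) i)
  -- contraction on `B`
  have hnormM : ∀ (N : Matrix (Fin d) (Fin d) ℤ_[p]) (v : Fin d → ℤ_[p]) (C : ℝ), 0 ≤ C →
      (∀ i, ‖v i‖ ≤ C) → ∀ i, ‖N.mulVec v i‖ ≤ C := by
    intro N v C hC hv i
    simp only [Matrix.mulVec, dotProduct]
    refine IsUltrametricDist.norm_sum_le_of_forall_le_of_nonneg hC fun k _ ↦ ?_
    rw [norm_mul]
    calc ‖N i k‖ * ‖v k‖ ≤ 1 * C := mul_le_mul (PadicInt.norm_le_one _) (hv k) (norm_nonneg _) zero_le_one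
      _ = C := one_mul C
  have hlip : ∀ x ∈ B, ∀ y ∈ B, dist (Φ x) (Φ y) ≤ (p : ℝ) ^ (-(s : ℤ)) * dist x y := by
    intro x hx y hy
    rw [dist_pi_le_iff (mul_nonneg hps.le dist_nonneg)]
    intro i
    rw [dist_eq_norm]
    -- `Φ x - Φ y = -M (F x - F y - J (x - y))`
    set E : Fin d → ℤ_[p] := fun j ↦ FEval F x j - FEval F y j - J.mulVec (x - y) j
    have hEeq : FEval F x - FEval F y = J.mulVec (x - y) + E := by
      funext j; simp [E]
    have e : Φ x i - Φ y i = -(M.mulVec E i) := by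
      have : Φ x - Φ y = (x - y) - M.mulVec (FEval F x - FEval F y) := by
        simp only [Φ]; rw [Matrix.mulVec_sub]; abel
      have h2 : M.mulVec (J.mulVec (x - y)) = x - y := by
        rw [Matrix.mulVec_mulVec, hMJ, Matrix.one_mulVec]
      have h3 : Φ x - Φ y = -(M.mulVec E) := by
        rw [this, hEeq, Matrix.mulVec_add, h2]; abel
      exact congrFun h3 i
    rw [e, norm_neg]
    exact hnormM M E _ (mul_nonneg hps.le dist_nonneg) (fun j ↦ norm_linearisation_le F a x y s hx hy j) i
  -- completeness of `B` (it is closed)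
  have hBclosed : IsClosed B := by
    have : B = ⋂ i, {x : Fin d → ℤ_[p] | ‖x i - a i‖ ≤ (p : ℝ) ^ (-(s : ℤ))} := by
      ext x; simp [B, I, mem_span_pow_iff_norm]
    rw [this]
    refine isClosed_iInter fun i ↦ ?_
    exact isClosed_le (by fun_prop) continuous_const
  have hBcomplete : IsComplete B := hBclosed.isComplete
  have haB : a ∈ B := fun i ↦ by simp [I]
  -- apply the Banach fixed-point theorem on `B`
  have hcw : ContractingWith ⟨(p : ℝ) ^ (-(s : ℤ)), hps.le⟩ (hmaps.restrict Φ B B) := by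
    refine ⟨?_, ?_⟩
    · change (p : ℝ) ^ (-(s : ℤ)) < 1
      linarith
    · rw [lipschitzWith_iff_dist_le_mul]
      rintro ⟨x, hx⟩ ⟨y, hy⟩
      exact hlip x hx y hy
  obtain ⟨b, hbB, hfix, -, -⟩ :=
    hcw.exists_fixedPoint' (f := Φ) hBcomplete hmaps haB (edist_ne_top _ _)
  -- fixed points of `Φ` in `B` are exactly the zeros in `B`
  have hzero_iff : ∀ x, Function.IsFixedPt Φ x ↔ ∀ j, FEval F x j = 0 := by
    intro x
    constructor
    · intro hx
      have h1 : M.mulVec (FEval F x) = 0 := by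
        have := hx
        simp only [Function.IsFixedPt, Φ] at this
        have h' : x - M.mulVec (FEval F x) - x = 0 := by rw [this]; simp
        simpa using h'
      have h2 : J.mulVec (M.mulVec (FEval F x)) = FEval F x := by
        rw [Matrix.mulVec_mulVec, hJM, Matrix.one_mulVec]
      intro j
      have := congrFun h2 j
      rw [h1, Matrix.mulVec_zero] at this
      exact this.symm
    · intro hx
      have : FEval F x = 0 := funext hx
      simp only [Function.IsFixedPt, Φ, this, Matrix.mulVec_zero, sub_zero]
  refine ⟨b, ⟨(hzero_iff b).1 hfix, hbB⟩, ?_⟩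
  rintro b' ⟨hb'0, hb'B⟩
  -- uniqueness: two fixed points in `B`
  have hfix' : Function.IsFixedPt Φ b' := (hzero_iff b').2 hb'0
  by_contra hne
  have hpos : 0 < dist b' b := dist_pos.2 hne
  have := hlip b' hb'B b hbB
  rw [hfix'.eq, hfix.eq] at this
  nlinarith

end Padic

end Wooley
end Literature.NumberTheory.LFunctions
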